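import Literature.Geometry.Riemannian.ExponentialMap
import Literature.Geometry.Lorentzian.GeodesicUniformTime
import Literature.Geometry.Lorentzian.GeodesicExtension
import Literature.Analysis.ODE.FlowDomain
import HarnessLib

/-!
# Smooth dependence of geodesics on their initial data (Lee 2018, Thm. 4.27 / Prop. 5.19)

Layer 2 of the proof programme for `Literature.Geometry.Riemannian.lee_expMap_injectivityDomain`
(Lee 2018, Thm. 10.34; see `ExponentialMapProofs.lean`): the **geodesic flow is smooth**. For a
`C^k` covariant derivative `cov` on the tangent bundle of a Hausdorff manifold without boundary
(`1 ≤ k ≤ ∞`), the map `(p, t) ↦ (γ_p(t), γ_p'(t)) ∈ TM` — `γ_p` the maximal geodesic with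
initial data `p = (x, v) ∈ TM` (`maximalGeodesic cov x v` of `ExponentialMap.lean`) — is of class
`C^k` near every `(p₀, t₀)` with `t₀` in the domain of `γ_{p₀}`, and the domains are lower
semicontinuous in `p`. Lee 2018, Thm. 4.27 ("the geodesic flow … by the fundamental theorem on
flows") and Prop. 5.19 (a)–(c); Lang 1995, Ch. IV §1, Thms. 1.14–1.16 for the flow of a vector
field on a Banach space, PROVED in the tree (`Literature.Analysis.ODE.exists_contDiffOn_flow`).

This file, part (a): the **local** statement in a chart of `TM`
(`exists_nhds_contMDiffOn_geodesicFlow`), obtained exactly as the tree's local existence theorem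
`exists_nhds_uniform_isGeodesicOn` (O'Neill 1983, Ch. 3, Lemma 22) with Picard–Lindelöf replaced
by the `C^k` local flow of the first-order geodesic system `(u, w)' = (w, -∑ᵢ wⁱ Ĉᵢ(φ⁻¹ u) w)`:
* `exists_christoffelChart_contMDiffOn` — `C^k` Christoffel data `Ĉᵢ` on a chart neighbourhood
  (the `C^k` hypothesis on `cov` read in the trivialisation of `Hom(TM, TM)`);
* `contDiffOn_geodesicField` — the system is `C^k` on (chart ball) `× E`;
* `exists_nhds_contMDiffOn_geodesicFlow` — near every `p₀ ∈ TM` there are a neighbourhood `𝒰`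
  and `ε > 0` such that `(-ε, ε) ⊆ dom γ_p` for `p ∈ 𝒰` and
  `(p, t) ↦ tangentLift γ_p t` is `C^k` on `𝒰 × (-ε, ε)`.

No definitions, no named facts (D-0026).

## References

* J. M. Lee, *Introduction to Riemannian Manifolds*, 2nd ed. (2018), Thm. 4.27, Prop. 5.19.
  [LeeRiemannianManifolds2018]
* S. Lang, *Differential and Riemannian Manifolds* (1995), Ch. IV §1, Thms. 1.14, 1.16. [Lang1995]
* B. O'Neill, *Semi-Riemannian geometry* (1983), Ch. 3, Cor. 21, Lemma 22. [ONeill1983]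
-/

noncomputable section

open Bundle Set Filter Metric
open scoped Manifold ContDiff Topology

namespace Literature.Geometry.Riemannian

open Literature.Geometry.Lorentzian

variable {E : Type*} [NormedAddCommGroup E] [NormedSpace ℝ E] {H : Type*} [TopologicalSpace H]
  {I : ModelWithCorners ℝ E H} {M : Type*} [TopologicalSpace M] [ChartedSpace H M]
  [IsManifold I ∞ M] [FiniteDimensional ℝ E]
  {cov : CovariantDerivative I E (TangentSpace I : M → Type _)}

/-! ### `C^k` Christoffel data -/

/-- **`C^k` Christoffel data in a chart.** For a `C^k` connection (`k ≤ ∞`) on a Hausdorff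
manifold and a point `x₁` there are an open neighbourhood `N` of `x₁` inside the chart domain of
`x₁` and maps `Ĉᵢ : M → (E →L[ℝ] E)` of class `C^k` on `N` reading `w ↦ ∇_w sᵢ` in the
trivialisation at `x₁` for the coordinate frame `sᵢ` of the chart at `x₁`, at every point of `N`
(the construction of `exists_christoffelChart`, the regularity now read on all of `N` through the
trivialisation of `Hom(TM, TM)` at `x₁`, `Trivialization.contMDiffOn_section_iff`). Lee 2018,
Prop. 4.7 / O'Neill 1983, Ch. 3, Lemma 22 (smooth Christoffel symbols).
[cite: ONeill1983, Ch. 3, Lemma 22] -/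
theorem exists_christoffelChart_contMDiffOn [T2Space M] {k : ℕ∞}
    [CovariantDerivative.ContMDiffCovariantDerivative cov k]
    {ι : Type*} [Fintype ι] (b : Module.Basis ι ℝ E) (x₁ : M) :
    ∃ (N : Set M) (Ĉ : ι → M → (E →L[ℝ] E)), IsOpen N ∧ x₁ ∈ N ∧ N ⊆ (chartAt H x₁).source ∧
      (∀ y ∈ N, ∀ (i) (w : TangentSpace I y),
        Ĉ i y ((trivializationAt E (TangentSpace I) x₁).continuousLinearMapAt ℝ y w) =
          (trivializationAt E (TangentSpace I) x₁
            ⟨y, cov ((trivializationAt E (TangentSpace I) x₁).localFrame b i) y w⟩).2) ∧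
      ∀ i, ContMDiffOn I 𝓘(ℝ, E →L[ℝ] E) k (Ĉ i) N := by
  obtain ⟨ψ⟩ : Nonempty (SmoothBumpFunction I x₁) := inferInstance
  set e₁ := trivializationAt E (TangentSpace I : M → Type _) x₁ with he₁_def
  set σ : ι → Π y : M, TangentSpace I y := fun i ↦ (ψ : M → ℝ) • e₁.localFrame b i with hσ_def
  have hσ : ∀ i, CMDiff ∞ (T% (σ i)) := fun i ↦
    ContMDiffOn.smul_section_of_tsupport ψ.contMDiff.contMDiffOn (chartAt H x₁).open_source
      ψ.tsupport_subset_chartAt_source (e₁.contMDiffOn_localFrame_baseSet ∞ b i)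
  set N : Set M :=
    (chartAt H x₁).source ∩ extChartAt I x₁ ⁻¹' Metric.ball (extChartAt I x₁ x₁) ψ.rIn with hN_def
  have hN : IsOpen N := by
    have h := (continuousOn_extChartAt (I := I) x₁).isOpen_inter_preimage
      (isOpen_extChartAt_source x₁) (Metric.isOpen_ball (x := extChartAt I x₁ x₁) (ε := ψ.rIn))
    simpa only [extChartAt_source] using h
  have hx₁ : x₁ ∈ N := ⟨mem_chart_source H x₁, by simp [ψ.rIn_pos]⟩
  have hNs : N ⊆ (chartAt H x₁).source := inter_subset_left
  have hψN : ∀ y ∈ N, (ψ : M → ℝ) =ᶠ[𝓝 y] 1 := fun y hy ↦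
    ψ.eventuallyEq_one_of_dist_lt hy.1 (by simpa using hy.2)
  have hcov : ∀ y ∈ N, ∀ i, cov (σ i) y = cov (e₁.localFrame b i) y := by
    intro y hy i
    refine cov.isCovariantDerivativeOn.congr_of_eventuallyEq (s := univ)
      ((hσ i).contMDiffAt.mdifferentiableAt (by simp))
      ((contMDiffAt_localFrame_of_mem 1 e₁ b i (hNs hy)).mdifferentiableAt one_ne_zero)
      univ_mem ?_
    filter_upwards [hψN y hy] with y' hy'
    simp [hσ_def, hy']
  refine ⟨N, fun i y ↦ ContinuousLinearMap.inCoordinates E (TangentSpace I : M → Type _) E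
    (TangentSpace I : M → Type _) x₁ y x₁ y (cov (σ i) y), hN, hx₁, hNs, ?_, ?_⟩
  · intro y hy i w
    have hye : y ∈ e₁.baseSet := by simpa [he₁_def] using hNs hy
    beta_reduce
    rw [ContinuousLinearMap.inCoordinates_eq hye hye]
    simp only [ContinuousLinearMap.coe_comp, Function.comp_apply, ContinuousLinearEquiv.coe_coe,
      Trivialization.symm_continuousLinearEquivAt_eq, Trivialization.coe_continuousLinearEquivAt_eq]
    rw [Trivialization.symmL_continuousLinearMapAt _ hye, hcov y hy i,
      Trivialization.continuousLinearMapAt_apply_of_mem ℝ _ hye]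
  · intro i
    have hk1 : (k : ℕ∞ω) + 1 ≤ ∞ := by exact_mod_cast le_top
    have h1 : ContMDiffOn I (I.prod 𝓘(ℝ, E →L[ℝ] E)) k
        (fun y ↦ (⟨y, cov (σ i) y⟩ :
          TotalSpace (E →L[ℝ] E) (fun y : M ↦ TangentSpace I y →L[ℝ] TangentSpace I y))) N :=
      (CovariantDerivative.ContMDiffCovariantDerivative.contMDiff.contMDiff
        ((hσ i).of_le hk1).contMDiffOn).mono (subset_univ N)
    have hNb : N ⊆ (trivializationAt (E →L[ℝ] E)
        (fun y : M ↦ TangentSpace I y →L[ℝ] TangentSpace I y) x₁).baseSet := by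
      intro y hy
      rw [hom_trivializationAt_baseSet]
      have hye : y ∈ e₁.baseSet := by simpa [he₁_def] using hNs hy
      exact ⟨hye, hye⟩
    exact ((trivializationAt (E →L[ℝ] E)
      (fun y : M ↦ TangentSpace I y →L[ℝ] TangentSpace I y) x₁).contMDiffOn_section_iff
        hN hNb).1 h1

/-! ### The first-order geodesic system is `C^k` -/

/-- **The geodesic system is `C^k` on (chart ball) `× E`.** With `C^k` Christoffel data `Ĉᵢ` on
`N` and a chart ball `O` (open, `φ⁻¹ O ⊆ N`, `range I` a neighbourhood of each point of `O`,
as in `exists_chartBall`), the field `F(u, w) = (w, -∑ᵢ wⁱ Ĉᵢ(φ⁻¹ u) w)` of the first-order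
geodesic system (O'Neill 1983, Ch. 3, Cor. 21) is `C^k` on the open set `O × E`.
[cite: ONeill1983, Ch. 3, Cor. 21] -/
theorem contDiffOn_geodesicField {k : ℕ∞} {ι : Type*} [Fintype ι] (b : Module.Basis ι ℝ E)
    {x₁ : M} {N : Set M} (hN : IsOpen N) {Ĉ : ι → M → (E →L[ℝ] E)}
    (hĈs : ∀ i, ContMDiffOn I 𝓘(ℝ, E →L[ℝ] E) k (Ĉ i) N)
    {O : Set E} (hOt : O ⊆ (extChartAt I x₁).target)
    (hON : ∀ z ∈ O, (extChartAt I x₁).symm z ∈ N) (hOr : ∀ z ∈ O, range I ∈ 𝓝 z) :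
    ContDiffOn ℝ k (fun pq : E × E ↦ ((pq.2,
      -∑ i, b.repr pq.2 i • Ĉ i ((extChartAt I x₁).symm pq.1) pq.2) : E × E)) (O ×ˢ univ) := by
  set φ := extChartAt I x₁ with hφ_def
  -- `Ĉ i ∘ φ⁻¹` is `C^k` at every point of `O`
  have h1 : ∀ i, ∀ z ∈ O, ContDiffAt ℝ k (Ĉ i ∘ φ.symm) z := by
    intro i z hz
    have h2 : ContMDiffWithinAt 𝓘(ℝ, E) 𝓘(ℝ, E →L[ℝ] E) k (Ĉ i ∘ φ.symm) (range I) z := by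
      have h3 : ContMDiffWithinAt 𝓘(ℝ, E) I k φ.symm (range I) z :=
        contMDiffWithinAt_extChartAt_symm_range (I := I) (n := k) x₁ (hOt hz)
      have h4 : ContMDiffAt I 𝓘(ℝ, E →L[ℝ] E) k (Ĉ i) (φ.symm z) :=
        (hĈs i _ (hON z hz)).contMDiffAt (hN.mem_nhds (hON z hz))
      exact h4.comp_contMDiffWithinAt _ h3
    exact (contMDiffWithinAt_iff_contDiffWithinAt.mp h2).contDiffAt (hOr z hz)
  rintro pq ⟨hz, -⟩
  have hG : ContDiffAt ℝ k
      (fun pq : E × E ↦ -∑ i, b.repr pq.2 i • Ĉ i (φ.symm pq.1) pq.2) pq := by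
    have hC : ∀ i, ContDiffAt ℝ k (fun pq : E × E ↦ Ĉ i (φ.symm pq.1)) pq := fun i ↦
      ContDiffAt.comp (f := Prod.fst) pq (h1 i pq.1 hz) contDiffAt_fst
    have h4 : ∀ i, ContDiffAt ℝ k (fun pq : E × E ↦ b.repr pq.2 i) pq := fun i ↦
      (((b.coord i).toContinuousLinearMap).contDiff.comp contDiff_snd).contDiffAt
    exact (ContDiffAt.sum fun i _ ↦ (h4 i).smul ((hC i).clm_apply contDiffAt_snd)).neg
  exact (contDiffAt_snd.prodMk hG).contDiffWithinAt

/-! ### Geodesics with given initial data are restrictions of the maximal one -/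

section Maximal

variable [CompleteSpace E] [T2Space M] [BoundarylessManifold I M]
  [CovariantDerivative.ContMDiffCovariantDerivative cov 1]

/-- **A geodesic on an open interval about `0` is a restriction of the maximal geodesic with the
same initial data** (O'Neill 1983, Ch. 3, Prop. 24 / Lee 2018, Cor. 4.28: maximality and
uniqueness; the tree's `exists_isMaximalGeodesicOn` with `maximalGeodesic_unique`).
[cite: LeeRiemannianManifolds2018, Cor. 4.28] -/
theorem subset_maximalGeodesicDomain_of_isGeodesicOn {γ' : ℝ → M} {s' : Set ℝ}
    (hs' : IsOpen s') (hsc : s'.OrdConnected) (h0 : (0 : ℝ) ∈ s') (hγ' : IsGeodesicOn cov γ' s')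
    {x : M} {v : TangentSpace I x} (hx : γ' 0 = x) (hv : velocity I γ' 0 = v) :
    s' ⊆ maximalGeodesicDomain cov x v ∧ EqOn γ' (maximalGeodesic cov x v) s' := by
  obtain ⟨γ, s, hmax, h0s, hx0, hv0, huniv⟩ := exists_isMaximalGeodesicOn (cov := cov) x v
  obtain ⟨hsub, heq⟩ := huniv γ' s' hs' hsc h0 hγ' hx hv
  obtain ⟨hs, heq'⟩ := maximalGeodesic_unique (cov := cov) hmax h0s hx0 hv0
  refine ⟨hs ▸ hsub, fun t ht => ?_⟩
  rw [heq ht, heq' (hsub ht)]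

/-- Under the hypotheses of `subset_maximalGeodesicDomain_of_isGeodesicOn` the tangent lifts of
the geodesic and of the maximal geodesic agree on `s'` (velocities only see germs).
[cite: LeeRiemannianManifolds2018, Cor. 4.28] -/
theorem tangentLift_eqOn_maximalGeodesic_of_isGeodesicOn {γ' : ℝ → M} {s' : Set ℝ}
    (hs' : IsOpen s') (hsc : s'.OrdConnected) (h0 : (0 : ℝ) ∈ s') (hγ' : IsGeodesicOn cov γ' s')
    {x : M} {v : TangentSpace I x} (hx : γ' 0 = x) (hv : velocity I γ' 0 = v) :
    EqOn (tangentLift I γ') (tangentLift I (maximalGeodesic cov x v)) s' := by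
  intro t ht
  obtain ⟨-, heq⟩ := subset_maximalGeodesicDomain_of_isGeodesicOn hs' hsc h0 hγ' hx hv
  refine (tangentLift_congr_of_eventuallyEq (I := I) ?_).symm
  filter_upwards [hs'.mem_nhds ht] with t' ht' using (heq ht').symm

end Maximal

/-! ### The local `C^k` geodesic flow -/

/-- **The geodesic flow is `C^k` near every point of `TM`, for short times** (Lee 2018,
Thm. 4.27 / Prop. 5.19, local part; Lang 1995, Ch. IV §1, Thm. 1.14 for the flow in a chart).
For a covariant derivative `cov` on `TM` of class `C^k` (`1 ≤ k ≤ ∞`; also `C¹`, the class under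
which the tree's maximal geodesics `γ_p = maximalGeodesic cov x v`, `p = (x, v)`, are defined) on
a Hausdorff manifold without boundary and `p₀ ∈ TM`, there are a neighbourhood `𝒰` of `p₀` in
`TM` (open) and `ε > 0` such that `(-ε, ε) ⊆ dom γ_p` for all `p ∈ 𝒰` and the map
`(p, t) ↦ (γ_p(t), γ_p'(t)) ∈ TM` is `C^k` on `𝒰 × (-ε, ε)`. Proof: in the chart of `TM` at
`p₀` the geodesics are the solutions of the `C^k` first-order system `contDiffOn_geodesicField`
(`isGeodesicOn_of_chartSolution`), whose local flow is `C^k` jointly in the initial value and the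
time (`Literature.Analysis.ODE.exists_contDiffOn_flow`); each such solution is a restriction of
the maximal geodesic with the same initial data, and the chart maps of `TM` are smooth.
[cite: LeeRiemannianManifolds2018, Thm. 4.27 and Prop. 5.19] -/
theorem exists_nhds_contMDiffOn_geodesicFlow [CompleteSpace E] [T2Space M]
    [BoundarylessManifold I M] {k : ℕ∞} (hk : 1 ≤ k)
    [CovariantDerivative.ContMDiffCovariantDerivative cov k]
    [CovariantDerivative.ContMDiffCovariantDerivative cov 1] (p₀ : TangentBundle I M) :
    ∃ 𝒰 : Set (TangentBundle I M), IsOpen 𝒰 ∧ p₀ ∈ 𝒰 ∧ ∃ ε > (0 : ℝ),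
      (∀ p ∈ 𝒰, Ioo (-ε) ε ⊆ maximalGeodesicDomain cov p.proj p.2) ∧
      ContMDiffOn (I.tangent.prod 𝓘(ℝ, ℝ)) I.tangent k
        (fun q : TangentBundle I M × ℝ ↦ tangentLift I (maximalGeodesic cov q.1.proj q.1.2) q.2)
        (𝒰 ×ˢ Ioo (-ε) ε) := by
  set x₁ := p₀.proj with hx₁_def
  set b := Module.finBasis ℝ E with hb_def
  obtain ⟨N, Ĉ, hN, hxN, hNs, hĈ, hĈs⟩ := exists_christoffelChart_contMDiffOn (cov := cov) (k := k) b x₁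
  set φ := extChartAt I x₁ with hφ_def
  set e₁ := trivializationAt E (TangentSpace I : M → Type _) x₁ with he₁_def
  obtain ⟨O, hO, hxO, hOt, hON, hOr⟩ :=
    exists_chartBall (I := I) (BoundarylessManifold.isInteriorPoint (x := x₁)) hN hxN
  -- the first-order system and its `C^k` local flow around `z₀`
  set F : E × E → E × E := fun pq ↦
    (pq.2, -∑ i, b.repr pq.2 i • Ĉ i (φ.symm pq.1) pq.2) with hF_def
  have hF : ContDiffOn ℝ k F (O ×ˢ univ) := contDiffOn_geodesicField b hN hĈs hOt hON hOr
  set z₀ : E × E := (φ x₁, (e₁ p₀).2) with hz₀_def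
  have hz₀ : z₀ ∈ O ×ˢ (univ : Set E) := ⟨hxO, mem_univ _⟩
  obtain ⟨fl, r, hr, ε, hε, hfl0, hfld, hflU, hfls⟩ :=
    Literature.Analysis.ODE.exists_contDiffOn_flow (hO.prod isOpen_univ) hF hk hz₀
  -- the chart map `Z` of `TM` at `p₀` and the neighbourhood `𝒰`
  set Z : TangentBundle I M → E × E := fun p ↦ (φ p.proj, (e₁ p).2) with hZ_def
  have hp₀ : p₀ ∈ e₁.source := by
    rw [e₁.mem_source, he₁_def, TangentBundle.trivializationAt_baseSet]
    exact mem_chart_source H p₀.proj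
  have hZs : ContMDiffOn I.tangent 𝓘(ℝ, E × E) ∞ Z e₁.source := by
    refine ContMDiffOn.prodMk_space ?_ ?_
    · refine (contMDiffOn_extChartAt (I := I) (n := ∞) (x := x₁)).comp
        (Bundle.contMDiff_proj (TangentSpace I : M → Type _)).contMDiffOn ?_
      intro p hp
      simpa [he₁_def] using e₁.mem_source.1 hp
    · exact contMDiff_snd.comp_contMDiffOn e₁.contMDiffOn
  have hZc : ContinuousOn Z e₁.source := hZs.continuousOn
  have hZ₀ : Z p₀ = z₀ := rfl
  set 𝒰 : Set (TangentBundle I M) := e₁.source ∩ Z ⁻¹' ball z₀ r with h𝒰_def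
  have h𝒰o : IsOpen 𝒰 := hZc.isOpen_inter_preimage e₁.open_source isOpen_ball
  have h𝒰 : p₀ ∈ 𝒰 := ⟨hp₀, by rw [mem_preimage, hZ₀]; exact mem_ball_self hr⟩
  -- for `p ∈ 𝒰`, the flow line through `Z p` is a geodesic with initial data `p`
  have h0ε : (0 : ℝ) ∈ Ioo (-ε) ε := ⟨by linarith, hε⟩
  have key : ∀ p ∈ 𝒰,
      IsGeodesicOn cov (fun t ↦ φ.symm (fl (Z p) t).1) (Ioo (-ε) ε) ∧
      (∀ t ∈ Ioo (-ε) ε, (e₁ (tangentLift I (fun t ↦ φ.symm (fl (Z p) t).1) t)).2 =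
        (fl (Z p) t).2) ∧
      (fun t ↦ φ.symm (fl (Z p) t).1) 0 = p.proj ∧
      velocity I (fun t ↦ φ.symm (fl (Z p) t).1) 0 = p.2 := by
    rintro ⟨x, v⟩ hp
    set p : TangentBundle I M := ⟨x, v⟩ with hp_def
    have hps : x ∈ (chartAt H x₁).source := by
      simpa [he₁_def] using e₁.mem_source.1 hp.1
    obtain ⟨hgeo, hU⟩ := isGeodesicOn_of_chartSolution (cov := cov) b hNs Ĉ hĈ hO hOt hON hOr
      isOpen_Ioo (fun t ht ↦ hfld _ hp.2 t ht) (fun t ht ↦ (hflU _ hp.2 t ht).1)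
    have hf0 : fl (Z p) 0 = Z p := hfl0 _ hp.2
    have hγ0 : φ.symm (fl (Z p) 0).1 = x := by
      rw [hf0]
      exact φ.left_inv (by rwa [hφ_def, extChartAt_source])
    have hlift : tangentLift I (fun t ↦ φ.symm (fl (Z p) t).1) 0 = p := by
      refine eq_of_trivializationAt_snd_eq (x₁ := x₁)
        (by simpa only [tangentLift_proj] using hγ0 ▸ hps) hγ0 ?_
      rw [hU 0 h0ε, hf0]
    refine ⟨hgeo, hU, hγ0, ?_⟩
    exact eq_of_heq (TotalSpace.mk.inj hlift).2
  refine ⟨𝒰, h𝒰o, h𝒰, ε, hε, fun p hp ↦ ?_, ?_⟩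
  · obtain ⟨hgeo, -, hγ0, hv0⟩ := key p hp
    exact (subset_maximalGeodesicDomain_of_isGeodesicOn isOpen_Ioo ordConnected_Ioo h0ε hgeo
      hγ0 hv0).1
  -- smoothness: read the flow in the trivialisation `e₁`
  set Ψ : TangentBundle I M × ℝ → TangentBundle I M := fun q ↦
    tangentLift I (maximalGeodesic cov q.1.proj q.1.2) q.2 with hΨ_def
  set S : Set (TangentBundle I M × ℝ) := 𝒰 ×ˢ Ioo (-ε) ε with hS_def
  -- on `S`, `Ψ` is the flow line read back through the chart
  have hΨeq : ∀ q ∈ S, Ψ q = tangentLift I (fun t ↦ φ.symm (fl (Z q.1) t).1) q.2 := by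
    rintro ⟨p, t⟩ ⟨hp, ht⟩
    obtain ⟨hgeo, -, hγ0, hv0⟩ := key p hp
    exact (tangentLift_eqOn_maximalGeodesic_of_isGeodesicOn isOpen_Ioo ordConnected_Ioo h0ε hgeo
      hγ0 hv0 ht).symm
  have hbase : ∀ q ∈ S, (Ψ q).proj = φ.symm (fl (Z q.1) q.2).1 := fun q hq ↦ by
    rw [hΨeq q hq]; rfl
  have hfib : ∀ q ∈ S, (e₁ (Ψ q)).2 = (fl (Z q.1) q.2).2 := by
    rintro ⟨p, t⟩ ⟨hp, ht⟩
    obtain ⟨-, hU, -, -⟩ := key p hp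
    rw [hΨeq (p, t) ⟨hp, ht⟩]
    exact hU t ht
  have hsrc : ∀ q ∈ S, (Ψ q).proj ∈ (chartAt H x₁).source := fun q hq ↦ by
    rw [hbase q hq, ← extChartAt_source I]
    exact φ.map_target (hOt (hflU _ hq.1.2 _ hq.2).1)
  have hmaps : MapsTo Ψ S e₁.source := fun q hq ↦
    e₁.mem_source.2 (by simpa [he₁_def] using hsrc q hq)
  -- the composite `q ↦ fl (Z q.1) q.2` is `C^k` on `S`
  have hB : ContMDiffOn (I.tangent.prod 𝓘(ℝ, ℝ)) 𝓘(ℝ, (E × E) × ℝ) k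
      (fun q : TangentBundle I M × ℝ ↦ (Z q.1, q.2)) S := by
    refine ContMDiffOn.prodMk_space ?_ contMDiffOn_snd
    exact ((hZs.of_le (by exact_mod_cast le_top)).comp contMDiffOn_fst fun q hq ↦ hq.1.1)
  have hC : ContMDiffOn (I.tangent.prod 𝓘(ℝ, ℝ)) 𝓘(ℝ, E × E) k
      (fun q : TangentBundle I M × ℝ ↦ fl (Z q.1) q.2) S := by
    have hfl : ContMDiffOn 𝓘(ℝ, (E × E) × ℝ) 𝓘(ℝ, E × E) k
        (fun zt : (E × E) × ℝ ↦ fl zt.1 zt.2) (ball z₀ r ×ˢ Ioo (-ε) ε) :=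
      contMDiffOn_iff_contDiffOn.2 hfls
    exact hfl.comp hB fun q hq ↦ ⟨hq.1.2, hq.2⟩
  have hC1 : ContMDiffOn (I.tangent.prod 𝓘(ℝ, ℝ)) 𝓘(ℝ, E) k
      (fun q : TangentBundle I M × ℝ ↦ (fl (Z q.1) q.2).1) S :=
    (contDiff_fst (𝕜 := ℝ) (E := E) (F := E)).contMDiff.comp_contMDiffOn hC
  have hC2 : ContMDiffOn (I.tangent.prod 𝓘(ℝ, ℝ)) 𝓘(ℝ, E) k
      (fun q : TangentBundle I M × ℝ ↦ (fl (Z q.1) q.2).2) S :=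
    (contDiff_snd (𝕜 := ℝ) (E := E) (F := E)).contMDiff.comp_contMDiffOn hC
  rw [e₁.contMDiffOn_iff hmaps]
  constructor
  · have h1 : ContMDiffOn (I.tangent.prod 𝓘(ℝ, ℝ)) I k
        (fun q : TangentBundle I M × ℝ ↦ φ.symm (fl (Z q.1) q.2).1) S :=
      ((contMDiffOn_extChartAt_symm (I := I) (n := k) x₁).comp hC1
        fun q hq ↦ hOt (hflU _ hq.1.2 _ hq.2).1)
    exact h1.congr hbase
  · exact hC2.congr hfib

/-! ### The flow property of maximal geodesics -/

section Flow

variable [CompleteSpace E] [T2Space M] [BoundarylessManifold I M]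
  [CovariantDerivative.ContMDiffCovariantDerivative cov 1]

/-- `γ_p(0) = x`, `γ_p'(0) = v` and `0 ∈ dom γ_p` for `p = (x, v)` (the defining properties,
available unconditionally under the standing hypotheses). [cite: LeeRiemannianManifolds2018, Cor. 4.28] -/
theorem maximalGeodesic_spec' (x : M) (v : TangentSpace I x) :
    IsMaximalGeodesicOn cov (maximalGeodesic cov x v) (maximalGeodesicDomain cov x v) ∧
      (0 : ℝ) ∈ maximalGeodesicDomain cov x v ∧ maximalGeodesic cov x v 0 = x ∧
        velocity I (maximalGeodesic cov x v) 0 = v :=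
  maximalGeodesic_spec (hasMaximalGeodesic (cov := cov) x v)

/-- The tangent lift of `γ_p` at `0` is `p`. [cite: LeeRiemannianManifolds2018, Cor. 4.28] -/
theorem tangentLift_maximalGeodesic_zero (p : TangentBundle I M) :
    tangentLift I (maximalGeodesic cov p.proj p.2) 0 = p := by
  obtain ⟨x, v⟩ := p
  obtain ⟨-, -, h0, hv⟩ := maximalGeodesic_spec' (cov := cov) x v
  exact TotalSpace.ext h0 (heq_of_eq hv)

/-- **Flow property, forward half** (Lee 2018, proof of Thm. 4.27 via the fundamental theorem on
flows; O'Neill 1983, Ch. 3, Def. 20: translates of geodesics are geodesics): if `t₀ ∈ dom γ_p`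
and `q = (γ_p(t₀), γ_p'(t₀))`, then `s + t₀ ∈ dom γ_p` implies `s ∈ dom γ_q` and
`(γ_q(s), γ_q'(s)) = (γ_p(s + t₀), γ_p'(s + t₀))` — the translate `s ↦ γ_p(s + t₀)` is a geodesic
with initial data `q` (`IsGeodesicOn.comp_sub_const`), hence a restriction of `γ_q`.
[cite: LeeRiemannianManifolds2018, Thm. 4.27] -/
theorem maximalGeodesic_translate (x : M) (v : TangentSpace I x) {t₀ : ℝ}
    (ht₀ : t₀ ∈ maximalGeodesicDomain cov x v) {s : ℝ}
    (hs : s + t₀ ∈ maximalGeodesicDomain cov x v) :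
    s ∈ maximalGeodesicDomain cov (maximalGeodesic cov x v t₀)
        (velocity I (maximalGeodesic cov x v) t₀) ∧
      tangentLift I (maximalGeodesic cov (maximalGeodesic cov x v t₀)
          (velocity I (maximalGeodesic cov x v) t₀)) s =
        tangentLift I (maximalGeodesic cov x v) (s + t₀) := by
  obtain ⟨hmax, -, -, -⟩ := maximalGeodesic_spec' (cov := cov) x v
  set γ := maximalGeodesic cov x v with hγ
  set D := maximalGeodesicDomain cov x v with hD
  -- the translate `β s = γ (s - (-t₀)) = γ (s + t₀)` on `D' = D + (-t₀)`
  set β : ℝ → M := fun s ↦ γ (s - -t₀) with hβ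
  set D' : Set ℝ := (fun s ↦ s - -t₀) ⁻¹' D with hD'
  have hβgeo : IsGeodesicOn cov β D' := hmax.isGeodesicOn.comp_sub_const (-t₀)
  have hD'o : IsOpen D' := hmax.isOpen.preimage (continuous_id.sub continuous_const)
  have hD'c : D'.OrdConnected := by
    refine ⟨fun a ha c hc u hu ↦ ?_⟩
    show u - -t₀ ∈ D
    exact hmax.2.1.out ha hc ⟨by linarith [hu.1], by linarith [hu.2]⟩
  have h0 : (0 : ℝ) ∈ D' := by
    show (0 : ℝ) - -t₀ ∈ D
    simpa using ht₀
  have hβ0 : β 0 = γ t₀ := by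
    show γ (0 - -t₀) = γ t₀
    rw [zero_sub, neg_neg]
  have hβv : velocity I β 0 = velocity I γ t₀ := by
    rw [velocity_comp_sub_const γ (-t₀) 0, zero_sub, neg_neg]
  have hsD' : s ∈ D' := by
    show s - -t₀ ∈ D
    rwa [sub_neg_eq_add]
  obtain ⟨hsub, -⟩ := subset_maximalGeodesicDomain_of_isGeodesicOn hD'o hD'c h0 hβgeo hβ0 hβv
  refine ⟨hsub hsD', ?_⟩
  rw [← tangentLift_eqOn_maximalGeodesic_of_isGeodesicOn hD'o hD'c h0 hβgeo hβ0 hβv hsD',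
    tangentLift_comp_sub_const γ (-t₀) s, sub_neg_eq_add]

/-- **Flow property, backward half**: with `t₀ ∈ dom γ_p` and `q = (γ_p(t₀), γ_p'(t₀))`,
`s ∈ dom γ_q` implies `s + t₀ ∈ dom γ_p` (apply the forward half to `q` and `-t₀`, whose
translate has initial data `p`). Together: `dom γ_q = dom γ_p - t₀`.
[cite: LeeRiemannianManifolds2018, Thm. 4.27] -/
theorem add_mem_maximalGeodesicDomain_of_translate (x : M) (v : TangentSpace I x) {t₀ : ℝ}
    (ht₀ : t₀ ∈ maximalGeodesicDomain cov x v) {s : ℝ}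
    (hs : s ∈ maximalGeodesicDomain cov (maximalGeodesic cov x v t₀)
      (velocity I (maximalGeodesic cov x v) t₀)) :
    s + t₀ ∈ maximalGeodesicDomain cov x v := by
  obtain ⟨-, hD0, hx0, hv0⟩ := maximalGeodesic_spec' (cov := cov) x v
  -- `-t₀ ∈ dom γ_q` and the translate of `γ_q` by `-t₀` has initial data `p`
  have h1 : -t₀ + t₀ ∈ maximalGeodesicDomain cov x v := by simpa using hD0
  obtain ⟨hneg, hlift⟩ := maximalGeodesic_translate (cov := cov) x v ht₀ h1
  set q₁ := maximalGeodesic cov x v t₀ with hq₁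
  set w₁ : TangentSpace I q₁ := velocity I (maximalGeodesic cov x v) t₀ with hw₁
  -- data of `γ_q` at `-t₀`
  have hpt : maximalGeodesic cov q₁ w₁ (-t₀) = x ∧
      velocity I (maximalGeodesic cov q₁ w₁) (-t₀) = v := by
    have h := hlift
    rw [neg_add_cancel] at h
    have h' : tangentLift I (maximalGeodesic cov q₁ w₁) (-t₀) = ⟨x, v⟩ := by
      rw [h]
      exact TotalSpace.ext hx0 (heq_of_eq hv0)
    exact ⟨congrArg TotalSpace.proj h', eq_of_heq (TotalSpace.mk.inj h').2⟩
  have h2 : (s + t₀) + -t₀ ∈ maximalGeodesicDomain cov q₁ w₁ := by simpa using hs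
  obtain ⟨hmem, -⟩ := maximalGeodesic_translate (cov := cov) q₁ w₁ hneg h2
  rw [hpt.1] at hmem
  -- `hmem : s + t₀ ∈ dom (maximalGeodesic cov x (velocity … (-t₀)))`; rewrite the velocity
  convert hmem using 2
  exact hpt.2.symm

end Flow

/-! ### Globalisation along compact orbit segments -/

section Global

variable [CompleteSpace E] [T2Space M] [BoundarylessManifold I M] {k : ℕ∞}
  [CovariantDerivative.ContMDiffCovariantDerivative cov k]
  [CovariantDerivative.ContMDiffCovariantDerivative cov 1]

omit [CovariantDerivative.ContMDiffCovariantDerivative cov k] in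
/-- The tangent lift of a maximal geodesic is continuous on its domain (it is differentiable
there). [cite: LeeRiemannianManifolds2018, Cor. 4.28] -/
theorem continuousOn_tangentLift_maximalGeodesic (x : M) (v : TangentSpace I x) :
    ContinuousOn (tangentLift I (maximalGeodesic cov x v)) (maximalGeodesicDomain cov x v) :=
  fun _ ht ↦ ((maximalGeodesic_spec' (cov := cov) x v).1.isGeodesicOn.mdifferentiableAt_tangentLift
    ht).continuousAt.continuousWithinAt

/-- **The geodesic flow is `C^k` along whole orbit segments, and the domains are lower
semicontinuous** (Lee 2018, Thm. 4.27 with the fundamental theorem on flows, Prop. 5.19 (c);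
Lang 1995, Ch. IV §1, Thm. 1.16, whose proof — cover the compact orbit segment by finitely many
local flows, write the time-`T` map as an `N`-fold composite of time-`T/N` maps, compose `C^k`
maps — is followed here on `TM`). If `[0, T] ⊆ dom γ_{p₀}` then on a neighbourhood `𝒱` of `p₀`
in `TM` all `γ_p` are defined on `[0, T]` and `p ↦ (γ_p(T), γ_p'(T))` is `C^k`.
[cite: LeeRiemannianManifolds2018, Thm. 4.27 and Prop. 5.19 (c)] -/
theorem exists_nhds_contMDiffOn_geodesicFlow_of_subset (hk : 1 ≤ k) (p₀ : TangentBundle I M)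
    {T : ℝ} (hT : 0 ≤ T) (hTdom : Icc 0 T ⊆ maximalGeodesicDomain cov p₀.proj p₀.2) :
    ∃ 𝒱 : Set (TangentBundle I M), IsOpen 𝒱 ∧ p₀ ∈ 𝒱 ∧
      (∀ p ∈ 𝒱, Icc 0 T ⊆ maximalGeodesicDomain cov p.proj p.2) ∧
      ContMDiffOn I.tangent I.tangent k
        (fun p : TangentBundle I M ↦ tangentLift I (maximalGeodesic cov p.proj p.2) T) 𝒱 := by
  classical
  -- local flows everywhere
  choose 𝒰 h𝒰o hmem ε hε hdom hsmooth using fun q : TangentBundle I M ↦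
    exists_nhds_contMDiffOn_geodesicFlow (cov := cov) hk q
  -- the compact orbit segment and a finite subcover
  set Φ₀ : ℝ → TangentBundle I M := tangentLift I (maximalGeodesic cov p₀.proj p₀.2) with hΦ₀
  have hK : IsCompact (Φ₀ '' Icc 0 T) :=
    isCompact_Icc.image_of_continuousOn
      ((continuousOn_tangentLift_maximalGeodesic _ _).mono hTdom)
  obtain ⟨t, ht⟩ := hK.elim_finite_subcover 𝒰 (fun q ↦ h𝒰o q)
    (fun q _ ↦ mem_iUnion.2 ⟨q, hmem q⟩)
  have htne : t.Nonempty := by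
    have h0 : Φ₀ 0 ∈ Φ₀ '' Icc 0 T := mem_image_of_mem _ ⟨le_rfl, hT⟩
    obtain ⟨q, hq, -⟩ := mem_iUnion₂.1 (ht h0)
    exact ⟨q, hq⟩
  set ε₀ : ℝ := t.inf' htne ε with hε₀
  have hε₀pos : 0 < ε₀ := (Finset.lt_inf'_iff htne).2 fun q _ ↦ hε q
  have hε₀le : ∀ q ∈ t, ε₀ ≤ ε q := fun q hq ↦ Finset.inf'_le ε hq
  -- the number of steps and the step `τ = T / N < ε₀`
  obtain ⟨N, hN⟩ := exists_nat_gt (T / ε₀)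
  have hNpos' : (0 : ℝ) < N := lt_of_le_of_lt (div_nonneg hT hε₀pos.le) hN
  have hNpos : 0 < N := by exact_mod_cast hNpos'
  set τ : ℝ := T / N with hτ
  have hτ0 : 0 ≤ τ := div_nonneg hT (Nat.cast_nonneg N)
  have hτε : τ < ε₀ := by
    rw [hτ, div_lt_iff₀ hNpos']
    calc T = (T / ε₀) * ε₀ := by field_simp
      _ < N * ε₀ := by gcongr
      _ = ε₀ * N := mul_comm _ _
  have hNτ : (N : ℝ) * τ = T := by
    rw [hτ]
    field_simp
  -- induction on the number of steps
  have step : ∀ j : ℕ, j ≤ N → ∃ 𝒱 : Set (TangentBundle I M), IsOpen 𝒱 ∧ p₀ ∈ 𝒱 ∧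
      (∀ p ∈ 𝒱, Icc 0 ((j : ℝ) * τ) ⊆ maximalGeodesicDomain cov p.proj p.2) ∧
      ContMDiffOn I.tangent I.tangent k
        (fun p : TangentBundle I M ↦
          tangentLift I (maximalGeodesic cov p.proj p.2) ((j : ℝ) * τ)) 𝒱 := by
    intro j
    induction j with
    | zero =>
      intro _
      refine ⟨univ, isOpen_univ, mem_univ _, fun p _ s hs ↦ ?_, ?_⟩
      · have hs0 : s = 0 := le_antisymm (by simpa using hs.2) hs.1
        rw [hs0]
        exact (maximalGeodesic_spec' (cov := cov) p.proj p.2).2.1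
      · simp only [Nat.cast_zero, zero_mul]
        exact contMDiffOn_id.congr fun p _ ↦ tangentLift_maximalGeodesic_zero (cov := cov) p
    | succ j ih =>
      intro hj
      obtain ⟨𝒱, h𝒱o, hp𝒱, hdomj, hsmj⟩ := ih (Nat.le_of_succ_le hj)
      have hjτ0 : 0 ≤ (j : ℝ) * τ := mul_nonneg (Nat.cast_nonneg j) hτ0
      -- the point of the orbit at time `j τ` lies in one of the local flows
      have hjτT : (j : ℝ) * τ ∈ Icc 0 T := by
        refine ⟨hjτ0, ?_⟩
        calc (j : ℝ) * τ ≤ N * τ := by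
              gcongr
              exact_mod_cast Nat.le_of_succ_le hj
          _ = T := hNτ
      obtain ⟨q, hqt, hq⟩ := mem_iUnion₂.1 (ht (mem_image_of_mem Φ₀ hjτT))
      set Φj : TangentBundle I M → TangentBundle I M := fun p ↦
        tangentLift I (maximalGeodesic cov p.proj p.2) ((j : ℝ) * τ) with hΦj
      set 𝒱' : Set (TangentBundle I M) := 𝒱 ∩ Φj ⁻¹' 𝒰 q with h𝒱'
      have h𝒱'o : IsOpen 𝒱' := hsmj.continuousOn.isOpen_inter_preimage h𝒱o (h𝒰o q)
      have hp𝒱' : p₀ ∈ 𝒱' := ⟨hp𝒱, hq⟩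
      have hτq : τ ∈ Ioo (-(ε q)) (ε q) := ⟨by linarith [hε q], hτε.trans_le (hε₀le q hqt)⟩
      -- domains: `[0, (j+1)τ] ⊆ dom γ_p` for `p ∈ 𝒱'`
      have hdomj1 : ∀ p ∈ 𝒱', Icc 0 (((j + 1 : ℕ) : ℝ) * τ) ⊆
          maximalGeodesicDomain cov p.proj p.2 := by
        intro p hp s hs
        by_cases hsj : s ≤ j * τ
        · exact hdomj p hp.1 ⟨hs.1, hsj⟩
        · push Not at hsj
          have hjdom : (j : ℝ) * τ ∈ maximalGeodesicDomain cov p.proj p.2 :=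
            hdomj p hp.1 ⟨hjτ0, le_rfl⟩
          have hs' : s - j * τ ∈ Ioo (-(ε q)) (ε q) := by
            have h2 : s ≤ ((j + 1 : ℕ) : ℝ) * τ := hs.2
            push_cast at h2
            constructor
            · linarith [hε q]
            · linarith [hτq.2]
          have hmem' := hdom q (Φj p) hp.2 hs'
          have h3 := add_mem_maximalGeodesicDomain_of_translate (cov := cov) p.proj p.2 hjdom hmem'
          simpa using h3
      refine ⟨𝒱', h𝒱'o, hp𝒱', hdomj1, ?_⟩
      -- smoothness: `Φ_{(j+1)τ} = Φ_τ ∘ Φ_{jτ}` on `𝒱'`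
      have hcomp : ContMDiffOn I.tangent I.tangent k
          (fun p : TangentBundle I M ↦ tangentLift I
            (maximalGeodesic cov (Φj p).proj (Φj p).2) τ) 𝒱' := by
        have hinner : ContMDiffOn I.tangent (I.tangent.prod 𝓘(ℝ, ℝ)) k
            (fun p : TangentBundle I M ↦ (Φj p, τ)) 𝒱' :=
          (hsmj.mono inter_subset_left).prodMk contMDiffOn_const
        exact (hsmooth q).comp hinner fun p hp ↦ ⟨hp.2, hτq⟩
      refine hcomp.congr fun p hp ↦ ?_
      have hjdom : (j : ℝ) * τ ∈ maximalGeodesicDomain cov p.proj p.2 :=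
        hdomj p hp.1 ⟨hjτ0, le_rfl⟩
      have h1 : τ + j * τ ∈ maximalGeodesicDomain cov p.proj p.2 := by
        refine hdomj1 p hp ⟨by positivity, ?_⟩
        push_cast
        linarith
      obtain ⟨-, hlift⟩ := maximalGeodesic_translate (cov := cov) p.proj p.2 hjdom h1
      have h2 : ((j + 1 : ℕ) : ℝ) * τ = τ + j * τ := by
        push_cast
        ring
      rw [h2]
      exact hlift.symm
  obtain ⟨𝒱, h𝒱o, hp𝒱, hdomN, hsmN⟩ := step N le_rfl
  rw [hNτ] at hdomN hsmN
  exact ⟨𝒱, h𝒱o, hp𝒱, hdomN, hsmN⟩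

end Global

end Literature.Geometry.Riemannian
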